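import Summits.QuantumFields.BalabanUV.Beta.GAN24.ThreeLegFreezeBricks

/-!
# `BalabanUV.Beta.GAN24.ThreeLegSupBound` — binder row G-an2-4 ∕ (CONV-C), W-slot, the (α-0) parity re-cut, located crux (Q-L-k₀) (RULING R-gan24p1-g36-1 (4d)):
# **THE NAIVE THREE-LEG BOUND** (COUNT C-leaf01-g74-1 (i), as a lemma) — two slot weights and one kernel weight with SUP envelopes at blocking `L`, a four-index
# scalar function decaying from its first slot, the position block-summed: `|Σ'_x ρ x·Σ'_v h₁ v·Σ'_w h₂ w·Σ_t T v w x (L•c₄+t)| ≤ a_ρ·a₁·a₂·G·e^{5κ₀}·Zl(δ/2)³·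
# L^{d+1}·Zl(κ₀/(2(d+1)))·e^{−(κ₀/6)·spread}` — the currency in which the three GAUGE PAIRINGS of `LegPushGaugeSplit.vertex2W_dressed_eq` are priced (their
# tables are slot DIVERGENCES, bounded by the GoodL rows `g`, so no freezing is needed: `sup × sup × sup × g`).

NOT IN PRINT; OUR PROOF ([folklore] real analysis over PART 1's bricks; 0 `def`, 0 cited facts, 0 `def … : Prop`, 0 sorry, 0 wall binders).  HONEST FRAMING (cell
contract, verbatim): «discharging `BetaPertH` makes Bałaban's UV stability UNCONDITIONAL — a real constructive-QFT result; it is NOT the continuum limit and NOT the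
Clay problem.»  HONEST DEPENDENCY (verbatim): «continuum YM on T⁴ ⇐ BetaPertH ∧ nine spine estimates (0/9 proved); BetaPertH ⇐ (D1) ∧ (D4) ∧ CAP+tail; G-an2-4
gates asym, D1 and NE2/3/4.»

* `inner_sup_le`, `middle_sup_le`, **`abs_threeLeg_sup_le`** — hypotheses: `1 ≤ L`, `0 < κ₀`, `0 < δ`, `κ₀ ≤ (δ/6)·L` (the core's gap); `|h₁ v| ≤ a₁·E_{c₁}(v)`, `|h₂ w| ≤ a₂·E_{c₂}(w)`, `|ρ x| ≤ a_ρ·E_{c₃}(x)`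
  (`E_c(v) = e^{−κ₀‖quo L v − c‖∞}`); `|T v w x p| ≤ G·e^{−δ|w−v|₁}·e^{−δ(|x−v|₁+|p−v|₁)}`; conclusion as displayed (summability of every layer included).
Asserts NOTHING about Bałaban's tables; NOT (H1♮); NEVER «G-an2-4 closed» as (CONV-C); NOT D1, NOT `BetaPertH`, NOT continuum, NOT Clay; not in print.
Unit `b2b-balaban-gan24-formalise-leaf-01` (G-an2-4 formalisation swarm, leaf prover 01, gen 74), 2026-08-23.
-/

noncomputable section

open Finset
open scoped BigOperators
open Literature.MathematicalPhysics.QuantumFieldTheory.LatticeForm (quo)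
open Literature.MathematicalPhysics.QuantumFieldTheory.Balaban1983to89
open Literature.MathematicalPhysics.QuantumFieldTheory.Balaban1983to89.Beta
open B4ContourShift (supNorm supNorm_nonneg)
open B12Sec2to5 (l1 l1_nonneg)
open ExpKernelCalculus (Zl Zl_nonneg Zl_pos summable_exp_shift summable_exp_shift' tsum_exp_shift' l1_sub_symm)
open AffineAveraging (box toSite)
open Summit.QuantumFields.BalabanUV.Beta.GAN24.EnvelopeBlockSum (env_le_one tsum_env4_le)
open Summit.QuantumFields.BalabanUV.Beta.GAN24.ThreeLegFreezeBricks (env_transfer sum_box_exp_le)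

namespace Summit.QuantumFields.BalabanUV.Beta.GAN24.ThreeLegSupBound

variable {d : ℕ}

section Sup

variable {L : ℕ} {κ₀ δ a₁ a₂ aρ G : ℝ} {h₁ h₂ ρ : (Fin (d + 1) → ℤ) → ℝ}
  {T : (Fin (d + 1) → ℤ) → (Fin (d + 1) → ℤ) → (Fin (d + 1) → ℤ) → (Fin (d + 1) → ℤ) → ℝ}
  {c₁ c₂ c₃ c₄ : Fin (d + 1) → ℤ}
  (hL : 1 ≤ L) (hκ : 0 < κ₀) (hδ : 0 < δ) (hgap : κ₀ ≤ δ / 6 * L)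
  (ha₁ : 0 ≤ a₁) (ha₂ : 0 ≤ a₂) (haρ : 0 ≤ aρ) (hG : 0 ≤ G)
  (hh₁ : ∀ v, |h₁ v| ≤ a₁ * Real.exp (-(κ₀ * supNorm (quo L v - c₁))))
  (hh₂ : ∀ w, |h₂ w| ≤ a₂ * Real.exp (-(κ₀ * supNorm (quo L w - c₂))))
  (hρ : ∀ x, |ρ x| ≤ aρ * Real.exp (-(κ₀ * supNorm (quo L x - c₃))))
  (hT : ∀ v w x p, |T v w x p| ≤ G * Real.exp (-δ * l1 (w - v)) * Real.exp (-δ * (l1 (x - v) + l1 (p - v))))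

include hL hκ hgap in
/-- [folklore] The transfer gaps: `κ₀/L ≤ δ/6 ≤ δ/2`. -/
theorem rate_gap₂ : κ₀ / L ≤ δ / 6 ∧ κ₀ / L ≤ δ / 2 := by
  have hLr : (0 : ℝ) < (L : ℝ) := by exact_mod_cast hL
  have h6 : κ₀ / L ≤ δ / 6 := by rw [div_le_iff₀ hLr]; exact hgap
  have hδ0 : 0 ≤ δ := by
    have : 0 ≤ κ₀ / L := by positivity
    linarith
  exact ⟨h6, h6.trans (by linarith)⟩

include hL hκ hδ hgap ha₂ hG hh₂ hT in
/-- [folklore] **THE INNER SLOT AND THE POSITION BLOCK**, centred at the first slot `v`: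
`|Σ'_w h₂ w·Σ_t T v w x p_t| ≤ (a₂·G·e^{2κ₀}·Zl(δ/2)²)·E_{c₂}(v)·E_{c₄}(v)·e^{−δ|x−v|₁}` (summable). -/
theorem inner_sup_le (v x : Fin (d + 1) → ℤ) :
    (Summable fun w => h₂ w * ∑ t ∈ box (d + 1) L, T v w x ((L : ℤ) • c₄ + toSite t)) ∧
    |∑' w, h₂ w * ∑ t ∈ box (d + 1) L, T v w x ((L : ℤ) • c₄ + toSite t)|
      ≤ (a₂ * G * Real.exp κ₀ ^ 2 * Zl (d + 1) (δ / 2) ^ 2) * Real.exp (-(κ₀ * supNorm (quo L v - c₂))) *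
          Real.exp (-(κ₀ * supNorm (quo L v - c₄))) * Real.exp (-δ * l1 (x - v)) := by
  have hr := (rate_gap₂ (κ₀ := κ₀) (δ := δ) hL hκ hgap).2
  have hZ := Zl_nonneg (D := d + 1) (half_pos hδ)
  -- the position block, centred at `v`
  have hbox := sum_box_exp_le (d := d) hL hκ.le (κ := δ / 2) (δ' := δ) hr (by linarith) c₄ v
  rw [show δ - δ / 2 = δ / 2 by ring] at hbox
  -- pointwise bound of the summand
  have hpt : ∀ w, ‖h₂ w * ∑ t ∈ box (d + 1) L, T v w x ((L : ℤ) • c₄ + toSite t)‖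
      ≤ (a₂ * G * Real.exp κ₀ ^ 2 * Zl (d + 1) (δ / 2) * Real.exp (-(κ₀ * supNorm (quo L v - c₂))) *
          Real.exp (-(κ₀ * supNorm (quo L v - c₄))) * Real.exp (-δ * l1 (x - v))) * Real.exp (-(δ / 2) * l1 (w - v)) := by
    intro w
    rw [Real.norm_eq_abs, abs_mul]
    -- the leg's envelope transferred to `v`
    have hw := env_transfer (d := d) hL hκ.le c₂ v w
    have hexp : Real.exp (κ₀ / L * l1 (w - v)) ≤ Real.exp (δ / 2 * l1 (w - v)) := by
      rw [Real.exp_le_exp]; exact mul_le_mul_of_nonneg_right hr (l1_nonneg _)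
    have h2 : |h₂ w| ≤ a₂ * (Real.exp κ₀ * Real.exp (δ / 2 * l1 (w - v)) * Real.exp (-(κ₀ * supNorm (quo L v - c₂)))) :=
      (hh₂ w).trans (mul_le_mul_of_nonneg_left (hw.trans (by gcongr)) ha₂)
    -- the block-summed table slice
    have hS : |∑ t ∈ box (d + 1) L, T v w x ((L : ℤ) • c₄ + toSite t)|
        ≤ G * Real.exp (-δ * l1 (w - v)) * Real.exp (-δ * l1 (x - v)) *
            (Real.exp κ₀ * Real.exp (-(κ₀ * supNorm (quo L v - c₄))) * Zl (d + 1) (δ / 2)) := by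
      refine (Finset.abs_sum_le_sum_abs _ _).trans ?_
      calc ∑ t ∈ box (d + 1) L, |T v w x ((L : ℤ) • c₄ + toSite t)|
          ≤ ∑ t ∈ box (d + 1) L, G * Real.exp (-δ * l1 (w - v)) * Real.exp (-δ * l1 (x - v)) * Real.exp (-δ * l1 ((L : ℤ) • c₄ + toSite t - v)) :=
            Finset.sum_le_sum fun t _ => (hT v w x _).trans (le_of_eq (by rw [mul_add, Real.exp_add]; ring))
        _ = G * Real.exp (-δ * l1 (w - v)) * Real.exp (-δ * l1 (x - v)) * ∑ t ∈ box (d + 1) L, Real.exp (-δ * l1 ((L : ℤ) • c₄ + toSite t - v)) := by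
            rw [Finset.mul_sum]
        _ ≤ _ := mul_le_mul_of_nonneg_left hbox (by positivity)
    have e : Real.exp (δ / 2 * l1 (w - v)) * Real.exp (-δ * l1 (w - v)) = Real.exp (-(δ / 2) * l1 (w - v)) := by
      rw [← Real.exp_add]; congr 1; ring
    calc |h₂ w| * |∑ t ∈ box (d + 1) L, T v w x ((L : ℤ) • c₄ + toSite t)|
        ≤ (a₂ * (Real.exp κ₀ * Real.exp (δ / 2 * l1 (w - v)) * Real.exp (-(κ₀ * supNorm (quo L v - c₂))))) *
          (G * Real.exp (-δ * l1 (w - v)) * Real.exp (-δ * l1 (x - v)) *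
            (Real.exp κ₀ * Real.exp (-(κ₀ * supNorm (quo L v - c₄))) * Zl (d + 1) (δ / 2))) :=
          mul_le_mul h2 hS (abs_nonneg _) (by positivity)
      _ = (a₂ * G * Real.exp κ₀ ^ 2 * Zl (d + 1) (δ / 2) * Real.exp (-(κ₀ * supNorm (quo L v - c₂))) *
          Real.exp (-(κ₀ * supNorm (quo L v - c₄))) * Real.exp (-δ * l1 (x - v))) *
          (Real.exp (δ / 2 * l1 (w - v)) * Real.exp (-δ * l1 (w - v))) := by ring
      _ = _ := by rw [e]
  have hs := (summable_exp_shift' (half_pos hδ) v).mul_left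
    (a₂ * G * Real.exp κ₀ ^ 2 * Zl (d + 1) (δ / 2) * Real.exp (-(κ₀ * supNorm (quo L v - c₂))) *
      Real.exp (-(κ₀ * supNorm (quo L v - c₄))) * Real.exp (-δ * l1 (x - v)))
  refine ⟨Summable.of_norm_bounded hs hpt, ?_⟩
  have hb := tsum_of_norm_bounded hs.hasSum hpt
  rw [Real.norm_eq_abs, tsum_mul_left, tsum_exp_shift'] at hb
  refine hb.trans (le_of_eq ?_); ring

include hL hκ hδ hgap ha₁ ha₂ hG hh₁ hh₂ hT in
/-- [folklore] **THE OUTER SLOT**, all envelopes transferred to the kernel site `x`: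
`|Σ'_v h₁ v·Σ'_w h₂ w·Σ_t T v w x p_t| ≤ (a₁·a₂·G·e^{5κ₀}·Zl(δ/2)³)·E_{c₁}(x)·E_{c₂}(x)·E_{c₄}(x)` (summable). -/
theorem middle_sup_le (x : Fin (d + 1) → ℤ) :
    (Summable fun v => h₁ v * ∑' w, h₂ w * ∑ t ∈ box (d + 1) L, T v w x ((L : ℤ) • c₄ + toSite t)) ∧
    |∑' v, h₁ v * ∑' w, h₂ w * ∑ t ∈ box (d + 1) L, T v w x ((L : ℤ) • c₄ + toSite t)|
      ≤ (a₁ * a₂ * G * Real.exp κ₀ ^ 5 * Zl (d + 1) (δ / 2) ^ 3) * (Real.exp (-(κ₀ * supNorm (quo L x - c₁))) *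
          Real.exp (-(κ₀ * supNorm (quo L x - c₂))) * Real.exp (-(κ₀ * supNorm (quo L x - c₄)))) := by
  have hr6 := (rate_gap₂ (κ₀ := κ₀) (δ := δ) hL hκ hgap).1
  have hZ := Zl_nonneg (D := d + 1) (half_pos hδ)
  set B : ℝ := a₂ * G * Real.exp κ₀ ^ 2 * Zl (d + 1) (δ / 2) ^ 2 with hB
  have hB0 : 0 ≤ B := by rw [hB]; positivity
  have hI := fun v => (inner_sup_le hL hκ hδ hgap ha₂ hG hh₂ hT v x (c₄ := c₄)).2
  -- three envelopes from `v` to `x`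
  have htr : ∀ (c : Fin (d + 1) → ℤ) (v : Fin (d + 1) → ℤ), Real.exp (-(κ₀ * supNorm (quo L v - c)))
      ≤ Real.exp κ₀ * Real.exp (δ / 6 * l1 (x - v)) * Real.exp (-(κ₀ * supNorm (quo L x - c))) := by
    intro c v
    refine (env_transfer (d := d) hL hκ.le c x v).trans ?_
    rw [l1_sub_symm v x]
    have hexp : Real.exp (κ₀ / L * l1 (x - v)) ≤ Real.exp (δ / 6 * l1 (x - v)) := by
      rw [Real.exp_le_exp]; exact mul_le_mul_of_nonneg_right hr6 (l1_nonneg _)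
    have h0 : 0 ≤ Real.exp (-(κ₀ * supNorm (quo L x - c))) := (Real.exp_pos _).le
    have h1 : 0 ≤ Real.exp κ₀ := (Real.exp_pos _).le
    exact mul_le_mul_of_nonneg_right (mul_le_mul_of_nonneg_left hexp h1) h0
  have hpt : ∀ v, ‖h₁ v * ∑' w, h₂ w * ∑ t ∈ box (d + 1) L, T v w x ((L : ℤ) • c₄ + toSite t)‖
      ≤ (a₁ * B * Real.exp κ₀ ^ 3 * (Real.exp (-(κ₀ * supNorm (quo L x - c₁))) * Real.exp (-(κ₀ * supNorm (quo L x - c₂))) *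
          Real.exp (-(κ₀ * supNorm (quo L x - c₄))))) * Real.exp (-(δ / 2) * l1 (x - v)) := by
    intro v
    rw [Real.norm_eq_abs, abs_mul]
    have h1 := hh₁ v
    have h2 := hI v
    have e1 := htr c₁ v; have e2 := htr c₂ v; have e4 := htr c₄ v
    have hE : 0 ≤ Real.exp (-δ * l1 (x - v)) := (Real.exp_pos _).le
    calc |h₁ v| * |∑' w, h₂ w * ∑ t ∈ box (d + 1) L, T v w x ((L : ℤ) • c₄ + toSite t)|
        ≤ (a₁ * Real.exp (-(κ₀ * supNorm (quo L v - c₁)))) *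
          (B * Real.exp (-(κ₀ * supNorm (quo L v - c₂))) * Real.exp (-(κ₀ * supNorm (quo L v - c₄))) * Real.exp (-δ * l1 (x - v))) :=
          mul_le_mul h1 (by rw [hB]; exact h2) (abs_nonneg _) (by positivity)
      _ ≤ (a₁ * (Real.exp κ₀ * Real.exp (δ / 6 * l1 (x - v)) * Real.exp (-(κ₀ * supNorm (quo L x - c₁))))) *
          (B * (Real.exp κ₀ * Real.exp (δ / 6 * l1 (x - v)) * Real.exp (-(κ₀ * supNorm (quo L x - c₂)))) *
            (Real.exp κ₀ * Real.exp (δ / 6 * l1 (x - v)) * Real.exp (-(κ₀ * supNorm (quo L x - c₄)))) * Real.exp (-δ * l1 (x - v))) := by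
          gcongr
      _ = (a₁ * B * Real.exp κ₀ ^ 3 * (Real.exp (-(κ₀ * supNorm (quo L x - c₁))) * Real.exp (-(κ₀ * supNorm (quo L x - c₂))) *
          Real.exp (-(κ₀ * supNorm (quo L x - c₄))))) *
          (Real.exp (δ / 6 * l1 (x - v)) * Real.exp (δ / 6 * l1 (x - v)) * Real.exp (δ / 6 * l1 (x - v)) * Real.exp (-δ * l1 (x - v))) := by ring
      _ = _ := by
          congr 1
          rw [← Real.exp_add, ← Real.exp_add, ← Real.exp_add]; congr 1; ring
  have hs := (summable_exp_shift (half_pos hδ) x).mul_left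
    (a₁ * B * Real.exp κ₀ ^ 3 * (Real.exp (-(κ₀ * supNorm (quo L x - c₁))) * Real.exp (-(κ₀ * supNorm (quo L x - c₂))) *
      Real.exp (-(κ₀ * supNorm (quo L x - c₄)))))
  refine ⟨Summable.of_norm_bounded hs hpt, ?_⟩
  have hb := tsum_of_norm_bounded hs.hasSum hpt
  rw [Real.norm_eq_abs, tsum_mul_left] at hb
  have hZx : ∑' v : Fin (d + 1) → ℤ, Real.exp (-(δ / 2) * l1 (x - v)) = Zl (d + 1) (δ / 2) := by
    rw [← tsum_exp_shift' (D := d + 1) x]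
    exact tsum_congr fun v => by rw [l1_sub_symm]
  rw [hZx] at hb
  refine hb.trans (le_of_eq ?_)
  rw [hB]; ring

include hL hκ hδ hgap ha₁ ha₂ haρ hG hh₁ hh₂ hρ hT in
/-- NOT IN PRINT; OUR PROOF.  **THE NAIVE THREE-LEG BOUND** (COUNT C-leaf01-g74-1 (i) as a lemma; the currency of the gauge pairings): two slot weights and one
kernel weight with sup envelopes at blocking `L`, a four-index scalar function decaying from its first slot with constant `G`, the position block-summed:
`|Σ'_x ρ x·Σ'_v h₁ v·Σ'_w h₂ w·Σ_t T v w x (L•c₄ + t)| ≤ a_ρ·a₁·a₂·G·e^{5κ₀}·Zl(δ/2)³·L^{d+1}·Zl(κ₀/(2(d+1)))·e^{−(κ₀/6)(‖c₂−c₁‖∞+‖c₃−c₁‖∞+‖c₄−c₁‖∞)}`. -/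
theorem abs_threeLeg_sup_le :
    (Summable fun x => ρ x * ∑' v, h₁ v * ∑' w, h₂ w * ∑ t ∈ box (d + 1) L, T v w x ((L : ℤ) • c₄ + toSite t)) ∧
    |∑' x, ρ x * ∑' v, h₁ v * ∑' w, h₂ w * ∑ t ∈ box (d + 1) L, T v w x ((L : ℤ) • c₄ + toSite t)|
      ≤ aρ * a₁ * a₂ * G * Real.exp κ₀ ^ 5 * Zl (d + 1) (δ / 2) ^ 3 *
        ((L : ℝ) ^ (d + 1) * Zl (d + 1) (κ₀ / (2 * ((d : ℝ) + 1))) *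
          Real.exp (-(κ₀ / 6) * (supNorm (c₂ - c₁) + supNorm (c₃ - c₁) + supNorm (c₄ - c₁)))) := by
  have hZ := Zl_nonneg (D := d + 1) (half_pos hδ)
  have hE4 := tsum_env4_le (d := d) hL hκ c₁ c₂ c₃ c₄
  set K : ℝ := a₁ * a₂ * G * Real.exp κ₀ ^ 5 * Zl (d + 1) (δ / 2) ^ 3 with hK
  have hpt : ∀ x, ‖ρ x * ∑' v, h₁ v * ∑' w, h₂ w * ∑ t ∈ box (d + 1) L, T v w x ((L : ℤ) • c₄ + toSite t)‖
      ≤ (aρ * K) * (Real.exp (-(κ₀ * supNorm (quo L x - c₁))) * Real.exp (-(κ₀ * supNorm (quo L x - c₂))) *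
          Real.exp (-(κ₀ * supNorm (quo L x - c₃))) * Real.exp (-(κ₀ * supNorm (quo L x - c₄)))) := by
    intro x
    rw [Real.norm_eq_abs, abs_mul]
    have h := (middle_sup_le hL hκ hδ hgap ha₁ ha₂ hG hh₁ hh₂ hT (c₁ := c₁) (c₄ := c₄) x).2
    rw [← hK] at h
    calc |ρ x| * |∑' v, h₁ v * ∑' w, h₂ w * ∑ t ∈ box (d + 1) L, T v w x ((L : ℤ) • c₄ + toSite t)|
        ≤ (aρ * Real.exp (-(κ₀ * supNorm (quo L x - c₃)))) * (K * (Real.exp (-(κ₀ * supNorm (quo L x - c₁))) *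
            Real.exp (-(κ₀ * supNorm (quo L x - c₂))) * Real.exp (-(κ₀ * supNorm (quo L x - c₄))))) :=
          mul_le_mul (hρ x) h (abs_nonneg _) (by positivity)
      _ = _ := by ring
  have hs := hE4.1.mul_left (aρ * K)
  refine ⟨Summable.of_norm_bounded hs hpt, ?_⟩
  have hb := tsum_of_norm_bounded hs.hasSum hpt
  rw [Real.norm_eq_abs, tsum_mul_left] at hb
  refine (hb.trans (mul_le_mul_of_nonneg_left hE4.2 (by positivity))).trans (le_of_eq ?_)
  rw [hK]; ring

end Sup

end Summit.QuantumFields.BalabanUV.Beta.GAN24.ThreeLegSupBound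

end
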